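import Literature.NumberTheory.EllipticCurves.Gamma0RankinSelbergUnfolding
import Literature.NumberTheory.EllipticCurves.CuspFormConjugatedTrace
import Literature.NumberTheory.EllipticCurves.Gamma0EisensteinMoebius
import Literature.NumberTheory.Automorphic.FundamentalDomainCosetUnfolding
import Literature.NumberTheory.EllipticCurves.Gamma0RankinSelbergResidue
import Literature.NumberTheory.EllipticCurves.Gamma0EisensteinBound
import HarnessLib

/-!
# The Rankin–Selberg integral of `f ∈ S₂(Γ₀(N))` against the scaled Eisenstein series `E(tz, s)`,
# moved to the modular surface: `∫_{Γ₀(N)∖ℍ} |f|²y² G₁(tz, s) dμ = ∫_𝒟 G_f^{(t)} G₁(·, s) dμ`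

Topic `Literature/NumberTheory/EllipticCurves`; theorems only. For `f ∈ S₂(Γ₀(N))`, `t ∣ N` and real
`s > 1`, with `G₁(w, s) = Σ_{(c,d)=1}(Im w/|cw+d|²)ˢ = 2E(w, s)` (`levelEisensteinG 1`,
`Gamma0EisensteinMoebius`) and the conjugated trace `G_f^{(t)} = conjTrace N t f`
(`CuspFormConjugatedTrace`):

* `isHypFundamentalDomain_gamma0CosetDomain` — the CLOSED coset domain
  `F̄_N = ⋃_q {τ : g_q τ ∈ 𝒟}` of the tree's Rankin–Selberg unfolding on `Γ₀(N)` (its open version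
  `F_N = ⋃_q g_q⁻¹𝒟ᵒ` is the domain of `Gamma0RankinSelbergUnfolding.lintegral_domain_mul_eisenstein_eq`)
  is a fundamental domain of `Γ₀(N)` in the sense of `IsHypFundamentalDomain`, and
  `F_N =ᵐ F̄_N` (`gamma0Domain_ae_eq`);
* `conjAct_scaleGL_gamma0_eq_map_levelConj` — `D_t⁻¹ Γ₀(N) D_t = Γ^{(t)}` inside `GL₂(ℝ)` (`t ∣ N`);
* `coe_scaleGL_inv_smul` — `D_t⁻¹ • z = tz`;
* **`lintegral_domain_petDensity_mul_levelEisensteinG_scaled`** — for `t ∣ N`, `s > 1`: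
  `∫⁻_{F_N} |f(τ)|²(Im τ)² · G₁(tτ, s) dμ(τ) = ∫⁻_𝒟 G_f^{(t)}(w) G₁(w, s) dμ(w)` (in `ℝ≥0∞`):
  change of variables `τ = D_t w` (measure-preserving), transport of the fundamental domain
  (`IsHypFundamentalDomain.conjAct_inv_smul`) and coset unfolding
  (`setLIntegral_eq_setLIntegral_fd_sum_cosets`, `FundamentalDomainCosetUnfolding`), with the
  `SL₂(ℤ)`-invariance of `G₁` (`tsum_coprime_smul`).

With `Gamma0EisensteinMoebius` (`G_N = J_s(N)⁻¹Σ_{t∣N} μ(N/t)tˢG₁(t·, s)`) and the tree's Step A this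
turns the Rankin–Selberg integral of `f` at the cusp `∞` of `Γ₀(N)` into a finite combination of
integrals over the modular surface of horocycle data against the LEVEL-ONE Eisenstein series (next file).

## References

* R. A. Rankin, Proc. Cambridge Philos. Soc. 35 (1939), §4; H. Iwaniec, *Spectral Methods*, §2.4,
  §3.2, §7.1; F. Diamond, J. Shurman, GTM 228, §5.4.
-/

noncomputable section

open scoped MatrixGroups ModularForm Modular ENNReal NNReal Pointwise
open MeasureTheory Set Filter ModularGroup CongruenceSubgroup ConjAct
open UpperHalfPlane hiding I
open Literature.NumberTheory.Automorphic

namespace Literature.NumberTheory.EllipticCurves.ModularForms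

/-! ### 1. The closed coset domain of `Γ₀(N)` is a fundamental domain -/

section Domain

variable {N : ℕ} [Fintype (↥𝒮ℒ ⧸ (Gamma0 N : Subgroup (GL (Fin 2) ℝ)).subgroupOf 𝒮ℒ)]
variable (g : (↥𝒮ℒ ⧸ (Gamma0 N : Subgroup (GL (Fin 2) ℝ)).subgroupOf 𝒮ℒ) → SL(2, ℤ))
  (hg : ∀ q, (Matrix.SpecialLinearGroup.mapGL ℝ (g q) : GL (Fin 2) ℝ) = ((q.out : ↥𝒮ℒ) : GL (Fin 2) ℝ))

/-- The closed coset domain `⋃_q {τ : g_q τ ∈ 𝒟}` is measurable. [folklore] -/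
theorem measurableSet_gamma0CosetDomain : MeasurableSet (⋃ q, {τ : ℍ | g q • τ ∈ 𝒟}) :=
  MeasurableSet.iUnion fun q ↦ isClosed_fd.measurableSet.preimage (continuous_sl2z_smul (g q)).measurable

include hg in
/-- **`F̄_N = ⋃_q {τ : g_q τ ∈ 𝒟}` is a fundamental domain of `Γ₀(N)`** (as a subgroup of `GL₂(ℝ)`):
every orbit meets it (Mathlib `ModularGroup.exists_smul_mem_fd` and the coset of the moving matrix),
and off the null set of orbits meeting `𝒟 ∖ 𝒟ᵒ` two `Γ₀(N)`-equivalent points of it coincide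
(`eq_of_smul_eq_of_mem_fdo`, Serre's theorem). [cite: Iwaniec2002, §2.4 Prop. 2.4] -/
theorem isHypFundamentalDomain_gamma0CosetDomain :
    IsHypFundamentalDomain ((Gamma0 N).map (Matrix.SpecialLinearGroup.mapGL ℝ)) (⋃ q, {τ : ℍ | g q • τ ∈ 𝒟}) := by
  refine ⟨measurableSet_gamma0CosetDomain g, fun z ↦ ?_, ?_⟩
  · obtain ⟨s, hs⟩ := exists_smul_mem_fd z
    refine ⟨Matrix.SpecialLinearGroup.mapGL ℝ ((g (QuotientGroup.mk
      (⟨Matrix.SpecialLinearGroup.mapGL ℝ s, s, rfl⟩ : ↥𝒮ℒ)))⁻¹ * s),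
      Subgroup.mem_map_of_mem _ (inv_mul_mem_Gamma0_of_mk g hg s), ?_⟩
    refine mem_iUnion.mpr ⟨QuotientGroup.mk (⟨Matrix.SpecialLinearGroup.mapGL ℝ s, s, rfl⟩ : ↥𝒮ℒ), ?_⟩
    show g _ • (((g _)⁻¹ * s) • z) ∈ 𝒟
    rwa [smul_smul, mul_inv_cancel_left]
  · have hnull := volume_setOf_exists_smul_mem_fd_diff_fdo
    rw [ae_iff]
    refine measure_mono_null (fun z hz ↦ ?_) hnull
    simp only [mem_setOf_eq, not_forall, exists_prop] at hz
    obtain ⟨hzF, δ, hδ, hδF, hne⟩ := hz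
    obtain ⟨γ, hγ, rfl⟩ := hδ
    by_contra hgood
    simp only [mem_setOf_eq, not_exists] at hgood
    have hgood' : ∀ s : SL(2, ℤ), s • z ∈ 𝒟 → s • z ∈ 𝒟ᵒ := fun s hs ↦ by
      by_contra h; exact hgood s ⟨hs, h⟩
    obtain ⟨q, hq⟩ := mem_iUnion.mp hzF
    obtain ⟨r, hr⟩ := mem_iUnion.mp hδF
    change g r • (γ • z) ∈ 𝒟 at hr
    have hq' : g q • z ∈ 𝒟ᵒ := hgood' _ hq
    have hr' : g r • γ • z ∈ 𝒟ᵒ := by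
      have := hgood' (g r * γ) (by rwa [mul_smul])
      rwa [mul_smul] at this
    exact hne (eq_of_smul_eq_of_mem_fdo g hg hq' hr' hγ rfl).symm

omit [Fintype (↥𝒮ℒ ⧸ (Gamma0 N : Subgroup (GL (Fin 2) ℝ)).subgroupOf 𝒮ℒ)] in
/-- The open and the closed coset domains agree a.e. [folklore] -/
theorem gamma0Domain_ae_eq :
    (⋃ q, {τ : ℍ | g q • τ ∈ 𝒟ᵒ} : Set ℍ) =ᵐ[volume] (⋃ q, {τ : ℍ | g q • τ ∈ 𝒟}) := by
  have hsub : (⋃ q, {τ : ℍ | g q • τ ∈ 𝒟ᵒ} : Set ℍ) ⊆ ⋃ q, {τ : ℍ | g q • τ ∈ 𝒟} :=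
    iUnion_mono fun q τ hτ ↦ fdo_subset_fd hτ
  refine (ae_eq_set.mpr ⟨?_, ?_⟩)
  · exact measure_mono_null (fun x hx ↦ (hx.2 (hsub hx.1)).elim) (measure_empty (μ := volume))
  · refine measure_mono_null (fun τ hτ ↦ ?_) volume_setOf_exists_smul_mem_fd_diff_fdo
    obtain ⟨hτ1, hτ2⟩ := hτ
    obtain ⟨q, hq⟩ := mem_iUnion.mp hτ1
    refine ⟨g q, hq, fun h ↦ hτ2 (mem_iUnion.mpr ⟨q, h⟩)⟩

end Domain

/-! ### 2. `D_t⁻¹ Γ₀(N) D_t = Γ^{(t)}` and `D_t⁻¹ z = tz` -/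

section Conjugation

variable {N t : ℕ} [NeZero t]

/-- For `γ = (a b; c d)` with `t ∣ c` (`t ≥ 1`), the integer matrix `D_t⁻¹ γ D_t = (a, tb; c/t, d)` as an
element of `SL₂(ℤ)`. [folklore] -/
def conjByScale (t : ℕ) [NeZero t] (γ : SL(2, ℤ)) (h : (t : ℤ) ∣ γ 1 0) : SL(2, ℤ) :=
  ⟨!![γ 0 0, t * γ 0 1; γ 1 0 / t, γ 1 1], by
    obtain ⟨c, hc⟩ := h
    have ht : (t : ℤ) ≠ 0 := by exact_mod_cast NeZero.ne t
    have hdet := Matrix.det_fin_two (γ : Matrix (Fin 2) (Fin 2) ℤ)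
    rw [γ.det_coe, hc] at hdet
    rw [Matrix.det_fin_two_of, hc, Int.mul_ediv_cancel_left _ ht]
    linear_combination -hdet⟩

/-- `D_t · (D_t⁻¹ γ D_t) = γ · D_t` in `GL₂(ℝ)`. [folklore] -/
theorem scaleGL_mul_mapGL_conjByScale (γ : SL(2, ℤ)) (h : (t : ℤ) ∣ γ 1 0) :
    scaleGL t * (Matrix.SpecialLinearGroup.mapGL ℝ (conjByScale t γ h) : GL (Fin 2) ℝ) =
      Matrix.SpecialLinearGroup.mapGL ℝ γ * scaleGL t := by
  refine Units.ext (Matrix.ext fun i j ↦ ?_)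
  obtain ⟨c, hc⟩ := h
  have ht : (t : ℝ) ≠ 0 := by exact_mod_cast NeZero.ne t
  have hct : ((γ 1 0 / t : ℤ) : ℝ) = (γ 1 0 : ℝ) / t := by
    rw [hc, Int.mul_ediv_cancel_left _ (by exact_mod_cast NeZero.ne t)]
    push_cast; field_simp
  fin_cases i <;> fin_cases j <;>
    simp [Matrix.mul_apply, Fin.sum_univ_two, conjByScale, Matrix.SpecialLinearGroup.mapGL,
      Matrix.SpecialLinearGroup.toGL, Units.val_mul, hct] <;> field_simp

/-- `mapGL (-1) = -1` in `GL₂(ℝ)`. [folklore] -/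
theorem mapGL_neg_one : (Matrix.SpecialLinearGroup.mapGL ℝ (-1 : SL(2, ℤ)) : GL (Fin 2) ℝ) = -1 := by
  ext i j
  fin_cases i <;> fin_cases j <;> simp [Matrix.SpecialLinearGroup.mapGL, Matrix.SpecialLinearGroup.toGL]

omit [NeZero t] in
/-- `-1 ∈ Γ^{(t)}`. [folklore] -/
theorem neg_one_mem_levelConj : (-1 : SL(2, ℤ)) ∈ levelConj t N := by
  rw [levelConj, mem_conjGL]
  refine ⟨-1, by simp [Gamma0_mem], ?_⟩
  change (Matrix.SpecialLinearGroup.mapGL ℝ (-1 : SL(2, ℤ)) : GL (Fin 2) ℝ) =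
    scaleGL t * Matrix.SpecialLinearGroup.mapGL ℝ (-1 : SL(2, ℤ)) * (scaleGL t)⁻¹
  rw [mapGL_neg_one]
  simp

/-- **`D_t⁻¹ Γ₀(N) D_t = Γ^{(t)}`** (inside `GL₂(ℝ)`, for `t ∣ N`): the conjugate of the image of
`Γ₀(N)` by `D_t = diag(1, t)` is the image of `levelConj t N = conjGL (Gamma0 N) D_t`. [folklore] -/
theorem conjAct_scaleGL_gamma0_eq_map_levelConj (htN : t ∣ N) :
    toConjAct (scaleGL t)⁻¹ • ((Gamma0 N).map (Matrix.SpecialLinearGroup.mapGL ℝ)) =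
      (levelConj t N).map (Matrix.SpecialLinearGroup.mapGL ℝ) := by
  ext x
  rw [mem_conjAct_inv_smul_iff]
  constructor
  · rintro ⟨y, hy, hyx⟩
    -- `x = D_t⁻¹ y D_t = mapGL (conjByScale t y _)`
    have hN : ((N : ℤ)) ∣ y 1 0 := (ZMod.intCast_zmod_eq_zero_iff_dvd _ _).mp (Gamma0_mem.mp hy)
    have hdiv : (t : ℤ) ∣ y 1 0 := (Int.natCast_dvd_natCast.mpr htN).trans hN
    have hprod := scaleGL_mul_mapGL_conjByScale (t := t) y hdiv
    refine ⟨conjByScale t y hdiv, ?_, ?_⟩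
    · show conjByScale t y hdiv ∈ conjGL (Gamma0 N) (scaleGL t)
      rw [mem_conjGL]
      refine ⟨y, hy, ?_⟩
      change (Matrix.SpecialLinearGroup.mapGL ℝ y : GL (Fin 2) ℝ) =
        scaleGL t * Matrix.SpecialLinearGroup.mapGL ℝ (conjByScale t y hdiv) * (scaleGL t)⁻¹
      rw [hprod, mul_inv_cancel_right]
    · have hx : x = (scaleGL t)⁻¹ * Matrix.SpecialLinearGroup.mapGL ℝ y * scaleGL t := by
        rw [hyx]; group
      change (Matrix.SpecialLinearGroup.mapGL ℝ (conjByScale t y hdiv) : GL (Fin 2) ℝ) = x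
      rw [hx, mul_assoc, ← hprod, ← mul_assoc, inv_mul_cancel, one_mul]
  · rintro ⟨x', hx', rfl⟩
    change x' ∈ conjGL (Gamma0 N) (scaleGL t) at hx'
    rw [mem_conjGL] at hx'
    obtain ⟨y, hy, hyeq⟩ := hx'
    exact ⟨y, hy, hyeq⟩

/-- **`D_t⁻¹ • z = tz`**: the inverse scaling is the multiplication by `t` of the positive-real
action. [folklore] -/
theorem scaleGL_inv_smul_eq (z : ℍ) :
    (scaleGL t)⁻¹ • z = ((⟨t, by exact_mod_cast NeZero.pos t⟩ : {x : ℝ // 0 < x}) • z) := by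
  apply UpperHalfPlane.ext
  have h := coe_scaleGL_smul t ((scaleGL t)⁻¹ • z)
  rw [smul_inv_smul] at h
  have ht : (t : ℂ) ≠ 0 := by exact_mod_cast NeZero.ne t
  rw [UpperHalfPlane.coe_pos_real_smul]
  simp only [Complex.real_smul, Complex.ofReal_natCast]
  rw [eq_div_iff ht] at h
  rw [mul_comm, ← h]

end Conjugation

/-! ### 3. The scaled Rankin–Selberg integral on the modular surface -/

section Scaled

variable {N t : ℕ} [NeZero N] [NeZero t] [Fintype (↥𝒮ℒ ⧸ (Gamma0 N : Subgroup (GL (Fin 2) ℝ)).subgroupOf 𝒮ℒ)]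
variable (g : (↥𝒮ℒ ⧸ (Gamma0 N : Subgroup (GL (Fin 2) ℝ)).subgroupOf 𝒮ℒ) → SL(2, ℤ))
  (hg : ∀ q, (Matrix.SpecialLinearGroup.mapGL ℝ (g q) : GL (Fin 2) ℝ) = ((q.out : ↥𝒮ℒ) : GL (Fin 2) ℝ))

include hg in
/-- **Scaled unfolding, general form.** For `f ∈ S₂(Γ₀(N))`, `t ∣ N`, and a measurable
`SL₂(ℤ)`-invariant weight `h ≥ 0`:
`∫⁻_{F_N} |f(τ)|²(Im τ)² h(D_t⁻¹τ) dμ(τ) = ∫⁻_𝒟 G_f^{(t)}(w) h(w) dμ(w)`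
(`τ = D_t w`; `D_t⁻¹F̄_N` is a fundamental domain of `D_t⁻¹Γ₀(N)D_t = Γ^{(t)}`; coset unfolding of the
`Γ^{(t)}`-invariant `w ↦ |f(w/t)|²(Im w/t)² h(w)`). [cite: Rankin1939, §4] -/
theorem lintegral_domain_normSq_mul_invariant_scaled (htN : t ∣ N) (f : CuspForm (Gamma0 N) 2)
    {h : ℍ → ℝ≥0∞} (hm : Measurable h) (hinv : ∀ (A : SL(2, ℤ)) (w : ℍ), h (A • w) = h w) :
    ∫⁻ τ in ⋃ q, {τ : ℍ | g q • τ ∈ 𝒟ᵒ},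
        ENNReal.ofReal (‖f τ‖ ^ 2 * τ.im ^ 2) * h ((scaleGL t)⁻¹ • τ) =
      ∫⁻ w in 𝒟, ENNReal.ofReal (conjTrace N t f w) * h w := by
  classical
  haveI : Fintype (SL(2, ℤ) ⧸ levelConj t N) := Fintype.ofFinite _
  -- pass to the closed domain `F̄`
  set Fbar : Set ℍ := ⋃ q, {τ : ℍ | g q • τ ∈ 𝒟} with hFbar
  rw [setLIntegral_congr (gamma0Domain_ae_eq g)]
  -- the pull-back `ψ(w) = Φ_t(w) h(w)`
  set ψ : ℍ → ℝ≥0∞ := fun w ↦ ENNReal.ofReal (scaledDensity t f w) * h w with hψ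
  have hψm : Measurable ψ :=
    (continuous_scaledDensity (t := t) (ModularFormClass.continuous f)).measurable.ennreal_ofReal.mul hm
  -- change of variables `τ = D_t • w`
  have hcv : ∫⁻ τ in Fbar, ENNReal.ofReal (‖f τ‖ ^ 2 * τ.im ^ 2) * h ((scaleGL t)⁻¹ • τ) =
      ∫⁻ w in (fun w : ℍ ↦ scaleGL t • w) ⁻¹' Fbar, ψ w := by
    rw [← (measurePreserving_smul (scaleGL t) (volume : Measure ℍ)).setLIntegral_comp_preimage_emb
      (MeasurableEquiv.smul (scaleGL t)).measurableEmbedding]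
    refine setLIntegral_congr_fun ((measurableSet_gamma0CosetDomain g).preimage (measurable_const_smul _))
      (fun w _ ↦ ?_)
    show ENNReal.ofReal (‖f (scaleGL t • w)‖ ^ 2 * (scaleGL t • w).im ^ 2) * h ((scaleGL t)⁻¹ • scaleGL t • w) = ψ w
    rw [hψ, inv_smul_smul]
    rfl
  rw [hcv]
  -- `D_t⁻¹ F̄` is a fundamental domain of `Γ^{(t)}`
  have hF₁ : IsHypFundamentalDomain ((levelConj t N).map (Matrix.SpecialLinearGroup.mapGL ℝ))
      ((fun w : ℍ ↦ scaleGL t • w) ⁻¹' Fbar) := by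
    have h := (isHypFundamentalDomain_gamma0CosetDomain g hg).conjAct_inv_smul (scaleGL t)
    rw [conjAct_scaleGL_gamma0_eq_map_levelConj htN] at h
    have hset : (scaleGL t)⁻¹ • Fbar = (fun w : ℍ ↦ scaleGL t • w) ⁻¹' Fbar := by
      ext z; rw [Set.mem_inv_smul_set_iff, Set.mem_preimage]
    rwa [hset] at h
  -- `ψ` is `Γ^{(t)}`-invariant
  have hψinv : ∀ γ ∈ levelConj t N, ∀ w : ℍ, ψ (γ • w) = ψ w := by
    intro γ hγ w
    rw [hψ]
    dsimp only
    rw [scaledDensity_smul_of_mem f hγ, hinv]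
  rw [setLIntegral_eq_setLIntegral_fd_sum_cosets neg_one_mem_levelConj hF₁ hψm hψinv]
  -- identify the coset sum with `G_f^{(t)} · h`
  refine setLIntegral_congr_fun isClosed_fd.measurableSet (fun w _ ↦ ?_)
  rw [hψ]
  dsimp only
  simp_rw [hinv]
  rw [← Finset.sum_mul, conjTrace, invTrace_eq_sum,
    ENNReal.ofReal_sum_of_nonneg (fun q _ ↦ scaledDensity_nonneg (t := t) f _)]

include hg in
/-- **The scaled Rankin–Selberg integral on the modular surface.** For `f ∈ S₂(Γ₀(N))`, `t ∣ N`
and real `s > 1`: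
`∫⁻_{F_N} |f(τ)|² (Im τ)² G₁(tτ, s) dμ(τ) = ∫⁻_𝒟 G_f^{(t)}(w) G₁(w, s) dμ(w)`,
`F_N = ⋃_q g_q⁻¹𝒟ᵒ` the coset domain of the tree's unfolding, `G₁ = 2E(·, s)` the level-one series,
`G_f^{(t)} = conjTrace N t f` the conjugated trace (the general form with the `SL₂(ℤ)`-invariant weight
`G₁(·, s)`, `tsum_coprime_smul`, and `D_t⁻¹τ = tτ`). [cite: Rankin1939, §4] -/
theorem lintegral_domain_petDensity_mul_levelEisensteinG_scaled (htN : t ∣ N) (f : CuspForm (Gamma0 N) 2)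
    {s : ℝ} (hs : 1 < s) :
    ∫⁻ τ in ⋃ q, {τ : ℍ | g q • τ ∈ 𝒟ᵒ},
        ENNReal.ofReal (‖f τ‖ ^ 2 * τ.im ^ 2) *
          ENNReal.ofReal (levelEisensteinG 1
            ((⟨t, by exact_mod_cast NeZero.pos t⟩ : {x : ℝ // 0 < x}) • τ) s) =
      ∫⁻ w in 𝒟, ENNReal.ofReal (conjTrace N t f w) * ENNReal.ofReal (levelEisensteinG 1 w s) := by
  have hG1m : Measurable fun w : ℍ ↦ ENNReal.ofReal (levelEisensteinG 1 w s) := by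
    refine Measurable.ennreal_ofReal ?_
    unfold levelEisensteinG; exact measurable_tsum_coprime_dvd hs 1
  have hinv : ∀ (A : SL(2, ℤ)) (w : ℍ), ENNReal.ofReal (levelEisensteinG 1 (A • w) s) =
      ENNReal.ofReal (levelEisensteinG 1 w s) := by
    intro A w; unfold levelEisensteinG; rw [tsum_coprime_smul]
  rw [← lintegral_domain_normSq_mul_invariant_scaled g hg htN f hG1m hinv]
  refine lintegral_congr fun τ ↦ ?_
  rw [scaleGL_inv_smul_eq]

include hg in
/-- **The mass of the conjugated trace is the Petersson norm**: for `t ∣ N`,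
`∫⁻_𝒟 G_f^{(t)} dμ = ∫⁻_{F_N} |f|²y² dμ` (the general form with `h = 1`). [cite: Rankin1939, §4] -/
theorem lintegral_fd_conjTrace_eq (htN : t ∣ N) (f : CuspForm (Gamma0 N) 2) :
    ∫⁻ w in 𝒟, ENNReal.ofReal (conjTrace N t f w) =
      ∫⁻ τ in ⋃ q, {τ : ℍ | g q • τ ∈ 𝒟ᵒ}, ENNReal.ofReal (‖f τ‖ ^ 2 * τ.im ^ 2) := by
  have h := lintegral_domain_normSq_mul_invariant_scaled g hg htN f (h := fun _ ↦ (1 : ℝ≥0∞))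
    measurable_const (fun _ _ ↦ rfl)
  simp only [mul_one] at h
  exact h.symm

end Scaled

end Literature.NumberTheory.EllipticCurves.ModularForms

end
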